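import Summits.AtomisticToContinuum.Crystallization.Theorems.PricedLinkCensusStackingHingeSimilarStarNormalisationStar

/-!
# Route `PricedLinkCensus`, crux `StackingHinge` (stmt-AtomisticToContinuum-14993), line `Sketch`:
# stub `stub_similarStarNormalisation` (V3), support file IV — SCALE CONSTANCY ALONG A BOND

The local heart of the similarity normalisation.  Two points `x, p` carry EXACT SIMILAR stars
`x + tₓ Aₓ Fₓ` and `p + t_p A_p F_p` (`F ∈ {refStar a h, a • fccKissingPattern}`, `A` linear
isometries, `t > 0` dilations), each is a star point of the other (a symmetric bond), the star of
`p` exhausts the points of the star of `x` that come `1.07 m_p`-close to `p` (the bond-shell gap at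
`p`, `m_p` the nearest-neighbour distance of `p`), and the struts are pinned to `[m, 1.01 m]`.  Then
`t_p = tₓ` (`scale_eq_of_bond`).

Proof.  The bond has length `d = tₓ ‖v‖ = t_p ‖w‖` with `‖v‖, ‖w‖ ∈ {a, ρ}`, `ρ² = a²/3 + h²`; at
the ideal ratio `ρ = a` and there is nothing to prove, and equal strut types give `t_p = tₓ`
directly.  A MIXED bond is impossible: (i) `‖v‖ = a`, `‖w‖ = ρ ≠ a`: a companion `u` of `v` in
`Fₓ` (`‖u‖ = a`, `dist u v = a`) gives a point `z` of the star of `x` with `dist p z = d`, hence a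
point of the star of `p` of norm `ρ`, i.e. a second polar strut of `p` at distance exactly `ρ` from
the polar strut `w` — but two polar struts are `a` or `≥ 2h > ρ` apart; (ii) `‖v‖ = ρ ≠ a`,
`‖w‖ = a`: the triangle companion `u` of the polar strut `v` gives `z` with `dist p z = tₓ a <
1.07 m_p` (the two strut lengths agree to `1 %`), hence a strut of `p` of length `tₓ a / t_p =
a²/ρ ∉ {a, ρ}`.  All `[folklore]`.
-/

noncomputable section

namespace Summit.AtomisticToContinuum.Crystallization.Theorems.PricedHcpWindowsSimilarStarNormalisation

open Literature.MathematicalPhysics.StatisticalMechanics Literature.Geometry.DiscreteGeometry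
open Summit.AtomisticToContinuum.Crystallization.Theorems.PalmUnimodularRigidity.LayeredLawsSelectHcp

/-- Norm of a dilated rotated vector. [folklore] -/
theorem norm_smul_map {t : ℝ} (ht : 0 ≤ t)
    (A : EuclideanSpace ℝ (Fin 3) ≃ₗᵢ[ℝ] EuclideanSpace ℝ (Fin 3)) (u : EuclideanSpace ℝ (Fin 3)) :
    ‖t • A u‖ = t * ‖u‖ := by
  rw [norm_smul, Real.norm_of_nonneg ht, LinearIsometryEquiv.norm_map]

/-- Distance of two points of a similar star. [folklore] -/
theorem dist_add_smul_map (x : EuclideanSpace ℝ (Fin 3)) {t : ℝ} (ht : 0 ≤ t)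
    (A : EuclideanSpace ℝ (Fin 3) ≃ₗᵢ[ℝ] EuclideanSpace ℝ (Fin 3)) (u u' : EuclideanSpace ℝ (Fin 3)) :
    dist (x + t • A u) (x + t • A u') = t * dist u u' := by
  rw [dist_eq_norm, add_sub_add_left_eq_sub, ← smul_sub, ← map_sub, norm_smul_map ht,
    ← dist_eq_norm]

/-- Distance from the centre to a point of its similar star. [folklore] -/
theorem dist_self_add_smul_map (x : EuclideanSpace ℝ (Fin 3)) {t : ℝ} (ht : 0 ≤ t)
    (A : EuclideanSpace ℝ (Fin 3) ≃ₗᵢ[ℝ] EuclideanSpace ℝ (Fin 3)) (u : EuclideanSpace ℝ (Fin 3)) :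
    dist x (x + t • A u) = t * ‖u‖ := by
  rw [dist_comm, dist_eq_norm, add_sub_cancel_left, norm_smul_map ht]

/-- Points of a similar star are distinct iff their labels are. [folklore] -/
theorem add_smul_map_injective (x : EuclideanSpace ℝ (Fin 3)) {t : ℝ} (ht : 0 < t)
    (A : EuclideanSpace ℝ (Fin 3) ≃ₗᵢ[ℝ] EuclideanSpace ℝ (Fin 3)) :
    Function.Injective fun u : EuclideanSpace ℝ (Fin 3) => x + t • A u := by
  intro u u' h
  have h1 : t • A u = t • A u' := add_left_cancel h
  exact A.injective (smul_right_injective _ ht.ne' h1)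

section Bond

variable {a h : ℝ} (ha₁ : 189 / 200 ≤ a) (ha₂ : a ≤ 199 / 200) (hh₁ : 77 / 100 ≤ h)
  (hh₂ : h ≤ 163 / 200) {Fx Fp : Set (EuclideanSpace ℝ (Fin 3))}
  (hFx : Fx = (refStar a h : Set (EuclideanSpace ℝ (Fin 3))) ∨
    Fx = (fun p : EuclideanSpace ℝ (Fin 3) => a • p) ''
      (fccKissingPattern : Set (EuclideanSpace ℝ (Fin 3))))
  (hFp : Fp = (refStar a h : Set (EuclideanSpace ℝ (Fin 3))) ∨
    Fp = (fun p : EuclideanSpace ℝ (Fin 3) => a • p) ''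
      (fccKissingPattern : Set (EuclideanSpace ℝ (Fin 3))))
include ha₁ ha₂ hh₁ hh₂ hFx hFp

/-- **SCALE CONSTANCY ALONG A BOND.**  Let `x` carry the exact similar star `x + tₓ • Aₓ '' Fₓ`
with struts in `[mₓ, 1.01 mₓ]` and `p = x + tₓ Aₓ v` (`v ∈ Fₓ`) the star `p + t_p • A_p '' F_p` with
struts `≤ 1.01 m_p`, with `x = p + t_p A_p w` (`w ∈ F_p`); suppose every point of the star of `x`
other than `p` within `1.07 m_p` of `p` is a point of the star of `p`.  Then `t_p = tₓ`.
[folklore] -/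
theorem scale_eq_of_bond {x p : EuclideanSpace ℝ (Fin 3)} {tx tp mx mp : ℝ} (htx : 0 < tx)
    (htp : 0 < tp) {Ax Ap : EuclideanSpace ℝ (Fin 3) ≃ₗᵢ[ℝ] EuclideanSpace ℝ (Fin 3)}
    {v w : EuclideanSpace ℝ (Fin 3)} (hv : v ∈ Fx) (hpv : p = x + tx • Ax v) (hw : w ∈ Fp)
    (hxw : x = p + tp • Ap w)
    (hmx : ∀ u ∈ Fx, mx ≤ tx * ‖u‖ ∧ tx * ‖u‖ ≤ 101 / 100 * mx)
    (hmp : ∀ u ∈ Fp, tp * ‖u‖ ≤ 101 / 100 * mp)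
    (hgap : ∀ u ∈ Fx, x + tx • Ax u ≠ p → dist p (x + tx • Ax u) < 107 / 100 * mp →
      ∃ u' ∈ Fp, x + tx • Ax u = p + tp • Ap u') :
    tp = tx := by
  have ha : 0 < a := by linarith
  -- the bond length
  have hd1 : dist x p = tx * ‖v‖ := by rw [hpv, dist_self_add_smul_map x htx.le]
  have hd2 : dist x p = tp * ‖w‖ := by
    rw [dist_comm]
    conv_lhs => rw [hxw]
    rw [dist_self_add_smul_map p htp.le]
  have key : tx * ‖v‖ = tp * ‖w‖ := hd1.symm.trans hd2
  have hvpos : 0 < ‖v‖ := by linarith [(norm_bounds ha₁ ha₂ hh₁ hh₂ hFx hv).1]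
  have hwpos : 0 < ‖w‖ := by linarith [(norm_bounds ha₁ ha₂ hh₁ hh₂ hFp hw).1]
  have hmp0 : 0 < mp := by
    have := hmp w hw
    nlinarith [mul_pos htp hwpos]
  have heq_of_norm : ‖v‖ = ‖w‖ → tp = tx := fun heq => by
    rw [heq] at key
    exact (mul_right_cancel₀ hwpos.ne' key).symm
  -- points of the star of `x`, seen from `p` and from `x`
  have hzp : ∀ u, dist u v = a → x + tx • Ax u ≠ p := by
    intro u huv hzp
    rw [hpv] at hzp
    have := add_smul_map_injective x htx Ax hzp
    rw [this, dist_self] at huv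
    exact ha.ne' huv.symm
  have hdpz : ∀ u, dist u v = a → dist p (x + tx • Ax u) = tx * a := by
    intro u huv
    conv_lhs => rw [hpv]
    rw [dist_add_smul_map x htx.le, dist_comm, huv]
  have hdxz : ∀ u, dist x (x + tx • Ax u) = tx * ‖u‖ := fun u => dist_self_add_smul_map x htx.le Ax u
  have hdpz' : ∀ u', dist p (p + tp • Ap u') = tp * ‖u'‖ := fun u' =>
    dist_self_add_smul_map p htp.le Ap u'
  have hdxz' : ∀ u', dist x (p + tp • Ap u') = tp * dist w u' := by
    intro u'
    conv_lhs => rw [hxw]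
    rw [dist_add_smul_map p htp.le]
  by_cases hρ : a ^ 2 / 3 + h ^ 2 = a ^ 2
  · -- the ideal ratio: every strut has length `a`
    have hall : ∀ {F : Set (EuclideanSpace ℝ (Fin 3))} {u : EuclideanSpace ℝ (Fin 3)},
        (F = (refStar a h : Set (EuclideanSpace ℝ (Fin 3))) ∨
          F = (fun p : EuclideanSpace ℝ (Fin 3) => a • p) ''
            (fccKissingPattern : Set (EuclideanSpace ℝ (Fin 3)))) → u ∈ F → ‖u‖ = a := by
      intro F u hF hu
      rcases norm_cases ha₁ hF hu with h1 | ⟨h1, -⟩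
      · exact h1
      · rw [hρ] at h1
        exact (pow_left_inj₀ (norm_nonneg _) ha.le two_ne_zero).1 h1
    exact heq_of_norm ((hall hFx hv).trans (hall hFp hw).symm)
  rcases norm_cases ha₁ hFx hv with hva | ⟨hvρ, -⟩ <;>
    rcases norm_cases ha₁ hFp hw with hwa | ⟨hwρ, -⟩
  · exact heq_of_norm (hva.trans hwa.symm)
  · -- in-layer from `x`, polar from `p`: impossible
    exfalso
    obtain ⟨u, hu, hua, huv⟩ := exists_adj_inLayer ha₁ hFx hρ hv hva
    have hlt : dist p (x + tx • Ax u) < 107 / 100 * mp := by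
      rw [hdpz u huv, ← hva, key]
      have := hmp w hw
      linarith
    obtain ⟨u', hu', hzu'⟩ := hgap u hu (hzp u huv) hlt
    -- the new strut of `p` has the length of `w`
    have hnu' : ‖u'‖ = ‖w‖ := by
      have e := hdpz u huv
      rw [hzu', hdpz', ← hva, key] at e
      exact mul_left_cancel₀ htp.ne' e
    have hnu'ρ : ‖u'‖ ^ 2 = a ^ 2 / 3 + h ^ 2 := by rw [hnu', hwρ]
    -- and is at distance `‖w‖` from `w`
    have hdist : dist u' w = ‖w‖ := by
      have e := hdxz u
      rw [hzu', hdxz', hua, ← hva, key] at e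
      rw [dist_comm]
      exact mul_left_cancel₀ htp.ne' e
    have hu'w : u' ≠ w := by
      intro heq
      rw [heq, dist_self] at hdist
      exact hwpos.ne' hdist.symm
    rcases polar_dist_cases ha₁ hFp hρ hu' hw hu'w hnu'ρ hwρ with h1 | h4
    · apply hρ
      rw [← hwρ, ← hdist, h1]
    · rw [hdist, hwρ] at h4
      nlinarith
  · -- polar from `x`, in-layer from `p`: impossible
    exfalso
    obtain ⟨u, hu, -, huv⟩ := exists_adj_polar ha₁ hFx hρ hv hvρ
    -- the two strut lengths of `x` agree to `1 %`
    have hratio : a ≤ 101 / 100 * ‖v‖ := by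
      obtain ⟨v', hv', hv'a⟩ := exists_norm_eq ha₁ hFx
      have h1 := (hmx v hv).1
      have h2 := (hmx v' hv').2
      rw [hv'a] at h2
      have h3 : tx * a ≤ tx * (101 / 100 * ‖v‖) := by nlinarith
      exact le_of_mul_le_mul_left h3 htx
    have hlt : dist p (x + tx • Ax u) < 107 / 100 * mp := by
      rw [hdpz u huv]
      have h1 := hmp w hw
      rw [← key] at h1
      nlinarith
    obtain ⟨u', hu', hzu'⟩ := hgap u hu (hzp u huv) hlt
    have e1 : tp * ‖u'‖ = tx * a := by
      have e := hdpz u huv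
      rwa [hzu', hdpz'] at e
    rw [hwa] at key
    rcases norm_cases ha₁ hFp hu' with hu'a | ⟨hu'ρ, -⟩
    · rw [hu'a] at e1
      have htt : tp = tx := mul_right_cancel₀ ha.ne' e1
      rw [htt] at key
      have hv' : ‖v‖ = a := mul_left_cancel₀ htx.ne' key
      apply hρ
      rw [← hvρ, hv']
    · have hn : ‖u'‖ = ‖v‖ :=
        (pow_left_inj₀ (norm_nonneg _) (norm_nonneg _) two_ne_zero).1 (hu'ρ.trans hvρ.symm)
      rw [hn] at e1
      -- `tp ‖v‖ = tx a` and `tx ‖v‖ = tp a` force `‖v‖ = a`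
      have hsq : ‖v‖ ^ 2 * (tp * tx) = a ^ 2 * (tp * tx) := by
        linear_combination (tx * ‖v‖) * e1 + (tx * a) * key
      have hv' : ‖v‖ ^ 2 = a ^ 2 := mul_right_cancel₀ (mul_pos htp htx).ne' hsq
      apply hρ
      rw [← hvρ, hv']
  · exact heq_of_norm
      ((pow_left_inj₀ (norm_nonneg _) (norm_nonneg _) two_ne_zero).1 (hvρ.trans hwρ.symm))

end Bond

end Summit.AtomisticToContinuum.Crystallization.Theorems.PricedHcpWindowsSimilarStarNormalisation

end
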